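import Literature.NumberTheory.Automorphic.Liu2021.AppendixC.DefC1toC3
import Literature.AlgebraicGeometry.Motives.GoodReduction
import Mathlib.NumberTheory.RamificationInertia.Basic
import HarnessLib

/-!
# Liu 2021, Appendix C §C.4 «Integral models and uniformization» (print pp. 116–124): Proposition C.20,
# Definition C.21, Remarks C.22–C.23, Definition C.24, Lemma C.25, Proposition C.26, Remark C.27 — STATEMENTS
# AS PRINTED (named facts `def … : Prop` over the tree's vocabulary + ⟨CARRIER⟩ data; NO proof of anything)

[Liu2021] = Yifeng Liu, *Fourier–Jacobi cycles and arithmetic relative trace formula* (with an appendix by Chao Li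
and Yihang Zhu), Cambridge J. Math. **9** (2021), no. 1, 1–147 = arXiv:2102.11518.  SOURCES READ FOR THIS FILE: the
print text (held `paper:liu2021-fourier-jacobi-cycles-arithmetic-relative-trace-formula`, pages p0116–p0124; every
`(p. N)` below is a JOURNAL page) and the author's TeX source of record `FJcycle.tex` (md5
`6db49a74122d2cb0f224fa1b39488a0c`; every `l. NNNN` below is a line of that file).  NUMBERING (one counter per appendix,
cf. the sibling file `DefC1toC3`): **C.20** = Proposition `pr:integral_canonical` l. 4960–4968 (p. 117; proof
l. 4970–4995, pp. 118–119) · **C.21** = Definition `de:integral_canonical` l. 4998–5004 (p. 119) · **C.22** = Remark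
`re:integral_canonical` l. 5006–5012 (p. 119) · **C.23** = Remark l. 5015–5017 (p. 119) · set-up l. 5020–5028
(pp. 119–120) · **C.24** = Definition `de:supersingular` l. 5030–5036 (p. 120) · l. 5038–5071 (pp. 120–121: the
supersingular locus, the frame `ℙ` = display **(C.8)** `eq:frame`, **(C.9)** `eq:uniformization1`, the formal scheme `𝒩`
and **(C.10)** `eq:uniformization2`, the hermitian space `V̄` and its form **(C.11)** `eq:nearby_form`) · **C.25** = Lemma
`le:definite_nearby` l. 5074–5106 (p. 121; proof l. 5108–5115, p. 122, with display **(C.12)**) · **(C.13)** =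
`eq:nearby_definite` l. 5119–5122 and `K̄_𝔮` l. 5123 (p. 122) · `q_0^∧` l. 5126–5131 (p. 122) · **C.26** = Proposition
`pr:uniformization` l. 5135–5149 (p. 123; proof l. 5151–5190 with display **(C.14)**) · **C.27** = Remark l. 5193–5195
(p. 124).  Definition C.19 (`de:integral_connection`, l. 4921, p. 116), Lemma C.18 and display (C.7)
(`eq:integral_canonical`, l. 4955) belong to §C.3 / the opening of §C.4 and are the business of the sibling carpet
`AppendixC/SecC3Connection.lean` (squad TL, typer TL-t05; landed as ★ `SecC3Connection`: `DefC19Data` with fields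
`Osharp` = `O_{E♯_{V,Φ,𝔭}}`, `𝓜` = Def. C.19, `M0int` = `𝓜(𝕎_0^∞, Φ^c)_{L_0} ⊗ O_{E♯_{V,Φ,𝔭}}`, `bq0` = (C.7), and the named facts
`LemC18AsPrinted`, `DefC19SeparatedAsPrinted`, `DefC19ProperIffAsPrinted`); they are NOT redeclared here — where §C.4 uses
them they enter as explicit PARAMETERS or ⟨CARRIER⟩ fields (see «How the printed objects are typed»; no import chain between
the two section files, squad ruling TL-plan 2026-09-02T01:59:30Z).

DEDUP CENSUS (2026-09-02): no file of `lean/Literature` carries a `[cite: Liu2021, … C.20 … C.27]` tag (`rg`); the only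
tree mentions are Summits-side provenance comments («proof of Prop. C.20 p. 118») in
`Summits/HodgeConjecture/HodgeConjecture/Cruxes/HLiu418/Lines/F0_P6a_*`.  Reused BY NAME, not restated: `HermSpace`,
`HermSpace.gram`, `HermSpace.Gfin`, `HermSpace.IsSignatureN1At`, `HermSpace.ShimuraSystem` (Rem. C.2's
`{Sh(G, h_{V,τ'})_K}_K`), `conj`, `restr` (★ `AppendixC/DefC1toC3`); `IntegralModel`, `baseChange` (★
`Literature/AlgebraicGeometry/Motives/GoodReduction`, `…/Varieties`); `UnitaryGroup.localPi` (`U(J)(F_v)`),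
`UnitaryGroup.LocalGLPi`, `UnitaryGroup.localIntBox` (`Π_{w∣v} GL_N(𝒪_w)`), `UnitaryGroup.PlacesOver`,
`UnitaryGroup.placeForm`, `UnitaryGroup.LocalRing` (`E ⊗_F F_v`), `UnitaryGroup.conjLocal`, `UnitaryGroup.evalPlace`
(`U(J)(𝔸_{F,f}) →* U(J)(F_v)`), `galAdicCompletionMap`, `glInt` (★ `UnitaryGroupAutomorphicRep`,
`UnitaryGroupLocalFactors`, `UnitaryGroupRestrictedProduct`, `ReductiveGroupData`).

## The printed text (verbatim from `FJcycle.tex`, TeX macros resolved as in `DefC1toC3`: `\rV` = `V`, `\fp` = `𝔭`,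
## `\underline\fp` = `𝔭̲`, `\cM` = `𝓜`, `\rM` = `M`, `\cS` = `𝒮`, `\cN` = `𝒩`, `\bbP` = `ℙ`, `\bbA` = `𝔸` (the frame
## abelian scheme, NOT the adèles), `\ur` = `nr`, `\ssl` = `ss`, `\spl` = `spl`, `\tc` = `c`, `\tu` = `u`, `\tT` = `T`)

**§C.4 opening** (l. 4903): «In this subsection, we study integral models and uniformization of the Shimura varieties
introduced previously […]. We identify `E` as a subfield of `ℂ` via an element `τ' ∈ Φ_E`. We fix a hermitian space `V`
over `E` that has signature `(n−1,1)` at `τ := τ'|_F` and `(n,0)` at other places.»  l. 4906–4917 (the good prime,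
used from Def. C.19 on and by C.24–C.27): «Let `𝔭` be a prime of `F` such that • `𝔭` is inert [in] `E`, • the underlying
rational prime `p` is odd and unramified in `E`, • we may choose a self-dual lattice `Λ_𝔮` in `V ⊗_F F_𝔮` for every
`𝔮 ∈ 𝔭̲`, where `𝔭̲` denotes the set of all primes of `F` above `p` that are inert in `E`, • `L_0 = L_0^p × (L_0)_p` in
which `(L_0)_p` is the stabilizer of a self-dual lattice in `𝕎_0^∞ ⊗_{𝔸^∞} ℚ_p`, and `L_0^p` is sufficiently small. […]
We denote by `Spl_p` the set of primes of `F` above `p` that are split in `E`. […] Denote by `E♯_{V,Φ,𝔭}` the completion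
of `E♯_{V,Φ}` in `E_𝔭^{ac}`. We now consider subgroups `K` of the form `K = K^p × K_p^{𝔭̲} × K_{𝔭̲}`, where
`K_{𝔭̲} = ∏_{𝔮 ∈ 𝔭̲} K_𝔮` in which `K_𝔮` is the stabilizer of `Λ_𝔮`, and `K^p` is sufficiently small.»

**PROPOSITION C.20** (l. 4960–4968, p. 117), VERBATIM: «Let `V` be as in the beginning of this subsection. Let `𝔭` be a
prime of `F` inert in `E` such that its underlying rational prime is unramified in `E`. Denote by `𝔭̲` the set of all
primes of `F` with the same residue characteristic of `𝔭` that are inert in `E`. We fix a subgroup `K_𝔮 ⊆ U(V)(F_𝔮)`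
that is the stabilizer of a self-dual lattice in `V ⊗_F F_𝔮` for every `𝔮 ∈ 𝔭̲`, and put `K_{𝔭̲} := ∏_{𝔮 ∈ 𝔭̲} K_𝔮`. Then
the Shimura variety `Sh(G, h_{V,τ'})_{K_{𝔭̲}} := lim_{K^{𝔭̲}} Sh(G, h_{V,τ'})_{K^{𝔭̲} K_{𝔭̲}}` (see Remark C.2 for the
notation) over `E` has a (smooth) integral canonical model over `O_{E_𝔭}` in the sense of [Mil92, Definition 2.9].»

**DEFINITION C.21** (l. 4998–5004, p. 119), VERBATIM: «We denote by `𝒮(G, h_{V,τ'})_{K_{𝔭̲}}` the integral canonical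
model of `Sh(G, h_{V,τ'})_{K_{𝔭̲}}` over `O_{E_𝔭}` in Proposition C.20, on which the action of `U(V)(𝔸_F^{∞,𝔭̲})` extends
uniquely by the extension property. For an open compact subgroup `K ⊆ G(𝔸^∞) = U(V)(𝔸_F^∞)` of the form
`K = K^{𝔭̲} × K_{𝔭̲}`, we put `𝒮(G, h_{V,τ'})_K := 𝒮(G, h_{V,τ'})_{K_{𝔭̲}}/K^{𝔭̲}` which we refer as the *canonical integral
model* of `Sh(G, h_{V,τ'})_K` over `O_{E_𝔭}`. It is proper/smooth if `Sh(G, h_{V,τ'})_K` is.»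

**REMARK C.22** (l. 5006–5012, p. 119), VERBATIM: «The extension property of integral canonical models together with
Lemma C.18 implies that we have a canonical isomorphism
`𝓜(V, 𝕎_0^∞, Φ)_{K,L_0} ≃ 𝒮(G, h_{V,τ'})_K ×_{O_{E_𝔭}} (𝓜(𝕎_0^∞, Φ^c)_{L_0} ⊗_{O_{E_Φ,(p)}} O_{E♯_{V,Φ,𝔭}})`
under which `q_0` (C.7) corresponds to the projection to the second factor.»

**REMARK C.23** (l. 5015–5017, p. 119), VERBATIM: «Proposition C.20 is slightly stronger than the main result in [Kis10],
as the latter has to assume that `K_p` is hyperspecial maximal.» — a comparison with the literature; NOT a mathematical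
statement to type; recorded here only.

**Set-up** (l. 5020–5028, pp. 119–120): «At last, we review the uniformization of `𝓜(V, 𝕎_0^∞, Φ)_{K,L_0}` along the basic
locus, which is only used in Subsection 5.3. Let `E_𝔭^{nr}` be the maximal unramified extension of `E_𝔭` inside `E_𝔭^{ac}`.
Let `k := O_{E_𝔭^{nr}} ⊗_ℤ 𝔽_p` be the residue field of `E_𝔭^{nr}`. Put `𝓜(V, 𝕎_0^∞, Φ)^{nr}_{K,L_0} :=
𝓜(V, 𝕎_0^∞, Φ)_{K,L_0} ⊗_{O_{E♯_{V,Φ,𝔭}}} O_{E_𝔭^{nr}}` and `𝓜(V, 𝕎_0^∞, Φ)^{nr}_{K_{𝔭̲},L_0} :=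
lim_{K^p} lim_{K_p^{𝔭̲}} 𝓜(V, 𝕎_0^∞, Φ)^{nr}_{K^p K_p^{𝔭̲} K_{𝔭̲}, L_0}`.»

**DEFINITION C.24** (l. 5030–5036, p. 120), VERBATIM: «For an algebraically closed field `k'` containing `k`, we say that a
`k'`-point `(A_0, i_0, λ_0, η_0^p; A, i, λ, η^p, η_p^{spl}) ∈ 𝓜(V, 𝕎_0^∞, Φ)^{nr}_{K_{𝔭̲},L_0}(k')` is *supersingular* if the
`p`-divisible group `A[𝔭^∞]` is supersingular.»

l. 5038–5043 (p. 120): «Denote by `𝓜(V, 𝕎_0^∞, Φ)^{ss}_{K_{𝔭̲},L_0}` the supersingular locus of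
`𝓜(V, 𝕎_0^∞, Φ)^{nr}_{K_{𝔭̲},L_0} ⊗_{O_{E_𝔭^{nr}}} k`, which is a Zariski closed subset. Denote by
`𝓜(V, 𝕎_0^∞, Φ)^{ss,∧}_{K_{𝔭̲},L_0}` the completion of `𝓜(V, 𝕎_0^∞, Φ)^{nr}_{K,L_0}` along `𝓜(V, 𝕎_0^∞, Φ)^{ss}_{K_{𝔭̲},L_0}`, which
is a formal scheme over `O^∧_{E_𝔭^{nr}}`, where `O^∧_{E_𝔭^{nr}}` is the completion of `O_{E_𝔭^{nr}}`. The description of the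
uniformization of `𝓜(V, 𝕎_0^∞, Φ)^{ss,∧}_{K_{𝔭̲},L_0}` depends on the choice of a point
  (C.8) `ℙ = (𝔸_0, 𝕚_0, 𝛌_0, 𝛈_0^p; 𝔸, 𝕚, 𝛌, 𝛈^p, 𝛈_p^{spl}) ∈ 𝓜(V, 𝕎_0^∞, Φ)^{nr}_{K_{𝔭̲},L_0}(O_{E_𝔭^{nr}})`
such that `ℙ_k` is supersingular. In particular, we have the induced section
  (C.9) `ℙ^∧ : Spf O^∧_{E_𝔭^{nr}} → 𝓜(V, 𝕎_0^∞, Φ)^{ss,∧}_{K_{𝔭̲},L_0}`.»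
l. 5047–5071 (pp. 120–121): «We denote the base change of `(𝔸_0, 𝕚_0, 𝛌_0; 𝔸, 𝕚, 𝛌)` to `k` by
`(𝔸_{0k}, 𝕚_{0k}, 𝛌_{0k}; 𝔸_k, 𝕚_k, 𝛌_k)`. Moreover, we use `Spec k` as the reference point in the level structures
`(𝛈_0^p; 𝛈^p, 𝛈_p^{spl})`. We now attach to `ℙ` two objects: a formal scheme `𝒩` over `O^∧_{E_𝔭^{nr}}`, and a new hermitian
space `V̄` over `E`. • By a slight abuse of notation, let `(𝕏, 𝕚, 𝛌)` be the supersingular unitary `O_{F_𝔭}`-module induced from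
`(𝔸[𝔭^∞], 𝕚[𝔭^∞], 𝛌[𝔭^∞])` via [Mih, Theorem 3.3]. Similarly, we have `(𝕏_0, 𝕚_0, 𝛌_0)` obtained from `(𝔸_0, 𝕚_0, 𝛌_0)`. Let
`𝒩` be the relative Rapoport–Zink space parameterizing quasi-isogenies of the supersingular unitary `O_{F_𝔭}`-module
`(𝕏_k, 𝕚_k, 𝛌_k)` of signature `(n−1,1)` as introduced in Subsection 1.3, which is a formal scheme over `O^∧_{E_𝔭^{nr}}`. In
particular, the point `ℙ` induces a section (C.10) `ℙ^∧_{loc} : Spf O^∧_{E_𝔭^{nr}} → 𝒩`. • Now we define the new hermitian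
space. Put `V̄ := Hom_k((𝔸_{0k}, 𝕚_{0k}), (𝔸_k, 𝕚_k))_ℚ`, which is an `E`-vector space through `𝕚_{0k}`. We define a map
`( , )_{V̄} : V̄ × V̄ → E` given by the formula (C.11) `(x, y)_{V̄} = 𝕚_{0k}^{−1}(𝛌_{0k}^∨ ∘ y^∨ ∘ 𝛌_k ∘ x) ∈
𝕚_{0k}^{−1} End_k((𝔸_{0k}, 𝕚_{0k})) = E`, which is a hermitian form on `V̄`.»

**LEMMA C.25** (l. 5074–5106, p. 121), VERBATIM: «The hermitian space `V̄, ( , )_{V̄}` has the following properties: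
(1) `V̄` is of dimension `n` over `E`. (2) `V̄` is totally positive definite. (3) The composite map
`V̄ ⊗_ℚ 𝔸^{∞,p} → Hom_{E ⊗_ℚ 𝔸^{∞,p}}(H_1^{ét}(𝔸_{0k}, 𝔸^{∞,p}), H_1^{ét}(𝔸_k, 𝔸^{∞,p})) —(𝛈^p)^{−1}→ V ⊗_ℚ 𝔸^{∞,p}` is an
isomorphism of hermitian spaces over `F ⊗_ℚ 𝔸^{∞,p}`. (4) The composite map `∏_{𝔮 ∈ Spl_p} V̄ ⊗_E E_{𝔮^−} →
∏_{𝔮 ∈ Spl_p} Hom_{O_{E_{𝔮^−}}}(𝔸_{0k}[(𝔮^−)^∞], 𝔸_k[(𝔮^−)^∞]) ⊗_{O_{E_{𝔮^−}}} E_{𝔮^−} —(𝛈_p^{spl})^{−1}→ ∏_{𝔮 ∈ Spl_p} V ⊗_E E_{𝔮^−}`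
is an isomorphism of `∏_{𝔮 ∈ Spl_p} E_{𝔮^−}`-modules. (5) For every `𝔮 ∈ 𝔭̲`, the canonical map `V̄ ⊗_F F_𝔮 →
Hom_k((𝔸_{0k}[𝔮^∞], 𝕚_{0k}[𝔮^∞]), (𝔸_k[𝔮^∞], 𝕚_k[𝔮^∞])) ⊗_{O_{F_𝔮}} F_𝔮` is an isomorphism of `E_𝔮`-vector spaces. (6) For every
`𝔮 ∈ 𝔭̲ ∖ {𝔭}`, `Λ̄_𝔮 := Hom_k((𝔸_{0k}[𝔮^∞], 𝕚_{0k}[𝔮^∞]), (𝔸_k[𝔮^∞], 𝕚_k[𝔮^∞]))` is a self-dual lattice in `V̄ ⊗_F F_𝔮`. (7)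
`V̄ ⊗_F F_𝔭` does not admit a self-dual lattice.»

l. 5119–5123 (p. 122): «Lemma C.25(3,4) gives rise to an isomorphism (C.13) `ι_ℙ : V̄ ⊗_F 𝔸_F^{∞,𝔭̲} → V ⊗_F 𝔸_F^{∞,𝔭̲}` of
hermitian spaces over `𝔸_F^{∞,𝔭̲}`. Let `K̄_𝔮` be the stabilizer of `Λ̄_𝔮` in Lemma C.25(6) for every `𝔮 ∈ 𝔭̲ ∖ {𝔭}`, which
is a hyperspecial maximal subgroup of `U(V̄)(F_𝔮)`.»  l. 5126–5131 (p. 122): «Let `𝓜(𝕎_0^∞, Φ^c)^∧_{L_0}` be the completion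
of `𝓜(𝕎_0^∞, Φ^c)_{L_0} ⊗_{O_{E_Φ,(p)}} O_{E_𝔭^{nr}}` along the special fiber, which is isomorphic to a finite disjoint union of
`Spf O^∧_{E_𝔭^{nr}}`. Then (C.7) induces a morphism `q_0^∧ : 𝓜(V, 𝕎_0^∞, Φ)^{ss,∧}_{K_{𝔭̲},L_0} → 𝓜(𝕎_0^∞, Φ^c)^∧_{L_0}` of formal
schemes over `O^∧_{E_𝔭^{nr}}`.»

**PROPOSITION C.26** (l. 5135–5149, p. 123), VERBATIM: «The chosen point `ℙ` (C.8) induces the following Cartesian diagram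
  `U(V̄)(F) \ (𝒩 × U(V̄)(𝔸_F^{∞,𝔭}) / ∏_{𝔮 ∈ 𝔭̲∖{𝔭}} K̄_𝔮)  ——→  Spf O^∧_{E_𝔭^{nr}}`
  `        │ u_ℙ                                              │ q_0^∧ ∘ ℙ^∧`
  `        ↓                                                   ↓`
  `𝓜(V, 𝕎_0^∞, Φ)^{ss,∧}_{K_{𝔭̲},L_0}          ——q_0^∧——→      𝓜(𝕎_0^∞, Φ^c)^∧_{L_0}`
of formal schemes over `O^∧_{E_𝔭^{nr}}`, satisfying • `u_ℙ ∘ (ℙ^∧_{loc}, 1) = ℙ^∧` (see (C.9) and (C.10)), and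
• `u_ℙ ∘ T_{ḡ} = T_g ∘ u_ℙ` for every `g ∈ U(V)(𝔸_F^{∞,𝔭̲})` and `ḡ ∈ U(V̄)(𝔸_F^{∞,𝔭̲})` that correspond under `ι_ℙ` (C.13),
where `T_g` (resp. `T_{ḡ}`) denotes the Hecke translation on the target (resp. source) of `u_ℙ`.»

**REMARK C.27** (l. 5193–5195, p. 124), VERBATIM: «In fact, the morphism `u_ℙ` in Proposition C.26 is compatible with more
Hecke operators. Consider a prime `𝔮 ∈ 𝔭̲ ∖ {𝔭}`. For every double coset `K_𝔮 g K_𝔮 ⊆ U(V)(F_𝔮)`, we have the Hecke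
correspondence `T_{K_𝔮 g K_𝔮}` on the target of `u_ℙ` which is simply the Zariski closure of the usual Hecke correspondence
on the generic fiber; it is in fact étale. Then we have `u_ℙ^* T_{K_𝔮 g K_𝔮} = T_{K̄_𝔮 ḡ K̄_𝔮}` if `K_𝔮 g K_𝔮 = K̄_𝔮 ḡ K̄_𝔮`
under the canonical isomorphism `K_𝔮 \ U(V)(F_𝔮) / K_𝔮 ≃ K̄_𝔮 \ U(V̄)(F_𝔮) / K̄_𝔮`. Here, `T_{K̄_𝔮 ḡ K̄_𝔮}` denotes the
set-theoretical Hecke correspondence on the source of `u_ℙ`.»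

## How the printed objects are typed.  REAL = a genuine Mathlib / tree object.  ⟨CARRIER⟩ = posited datum (a FIELD of a
## data structure, or an explicit PARAMETER of a named fact) standing for a printed object that Mathlib and the tree
## cannot construct; nothing is asserted by a carrier; its printed meaning is quoted at the field.  READINGS U1–U8 are
## the only interpretive choices; none adds or drops a printed hypothesis.  This file declares NO instance, NO notation,
## NO axiom, and proves nothing (typer lint): objects that need typeclass structure are either REAL (and carry the
## tree's instances) or enter as parameters with instance-implicit binders.

* `F`, `E`, `c`, `Φ_F`, `Φ_E`, `τ'`, `τ = τ'|_F`: as in `DefC1toC3` (REAL; `restr F E τ'` = `τ'|_F`).  «`V` … signature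
  `(n−1,1)` at `τ` and `(n,0)` at other places» = `V : HermSpace F E` with `V.IsSignatureN1At (restr F E τ')` (REAL).
* «a prime `𝔭` of `F`» = `𝔭 : HeightOneSpectrum (𝓞 F)` (REAL).  «inert in `E`» = `IsInert`: the ideal `𝔭·𝓞_E` is prime
  (READING U1, the standard meaning).  «split in `E`» = `IsSplit`: two distinct primes of `E` above (U1).  «the underlying
  rational prime» / «residue characteristic» `p` = `residueChar 𝔭 := ringChar (𝓞_F ⧸ 𝔭)` (REAL).  «`p` unramified in `E`» =
  `IsUnramifiedRatPrime E p`: every prime of `E` containing `p` has ramification index `1` over `(p) ⊂ ℤ` (Mathlib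
  `Ideal.ramificationIdx`; REAL).  `𝔭̲` = `inertSet E 𝔭`, `Spl_p` = `splitSet E 𝔭` (REAL sets of primes of `F`).
* `O_{E_𝔭}`, `E_𝔭`: for the prime `𝔓` of `E` above the inert `𝔭` (unique; carried as a datum `𝔓 : PlacesOver E 𝔭`, READING
  U2) Mathlib's `𝔓.adicCompletionIntegers E ⊆ 𝔓.adicCompletion E` (REAL).
* `U(V)(F_𝔮)` = `localGroup V 𝔮 := UnitaryGroup.localPi E c n J 𝔮 ≤ ∏_{w∣𝔮} GL_n(E_w)` for `V` presented by its Gram matrix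
  `J = V.gram` (REAL; READING R4 of `DefC1toC3`: `V ⊗_F F_𝔮 = (E ⊗_F F_𝔮)^n = ∏_{w∣𝔮} E_w^n`).  «a self-dual lattice in
  `V ⊗_F F_𝔮`» (READING U3): a lattice `Λ = g · ∏_{w∣𝔮} 𝒪_w^n` given by a frame `g ∈ ∏_{w∣𝔮} GL_n(E_w)` whose Gram matrix
  `(c_* g_{c⁻¹w})ᵀ · J · g_w` is in `GL_n(𝒪_w)` for every `w ∣ 𝔮` (`IsSelfDualFrame`; self-dual = unimodular for the
  hermitian form); «the stabilizer of» it = `latticeStabilizer V 𝔮 g = U(V)(F_𝔮) ∩ g (∏_w GL_n(𝒪_w)) g⁻¹` (REAL);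
  «`K_𝔮` is the stabilizer of a self-dual lattice» = `IsSelfDualStabilizer`; «admits a self-dual lattice» =
  `AdmitsSelfDualLattice`.  «hyperspecial maximal» (l. 5123, an attribute of `K̄_𝔮`): no tree vocabulary for unitary
  groups — recorded, NOT typed.
* `U(V)(𝔸_F^{∞,𝔭̲})`, `U(V̄)(𝔸_F^{∞,𝔭})` (READING U4): the subgroup `awayFrom V S ≤ U(V)(𝔸_F^∞) = V.Gfin` of finite-adèlic
  points with TRIVIAL components at the places of `S` (`⨅_{𝔮 ∈ S} ker (evalPlace 𝔮)`; canonically isomorphic to the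
  printed restricted product away from `S`) (REAL).
* «open compact `K ⊆ G(𝔸^∞)` of the form `K = K^{𝔭̲} × K_{𝔭̲}`» (C.20/C.21): ⟨CARRIER⟩ predicate `IsLevel` of `Setup`, ANCHORED
  by two REAL fields: such `K` is open compact in `V.Gfin`, and its image under `evalPlace 𝔮` is `K_𝔮` for `𝔮 ∈ 𝔭̲`.
  (Writing the product decomposition `U(V)(𝔸_F^∞) = U(V)(𝔸_F^{∞,𝔭̲}) × ∏_{𝔮∈𝔭̲} U(V)(F_𝔮)` inside Mathlib's restricted
  product would need surgery lemmas the tree does not have; the two anchors are what §C.4 uses.)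
* `Sh(G, h_{V,τ'})_K` over `E` = `S.Sh K` for the Rem. C.2 system `S : V.ShimuraSystem τ'` (★ carrier structure of
  `DefC1toC3`; a datum).  `Sh(G,h_{V,τ'})_{K_{𝔭̲}} := lim_{K^{𝔭̲}} Sh_{K^{𝔭̲}K_{𝔭̲}}` (READING U5): the TOWER `K ↦ Sh_K` restricted
  to the levels `IsLevel K`, with its transition maps `S.tr` — Milne's integral canonical models are models of the tower
  with its prime-to-`𝔭̲` Hecke action, and Def. C.21 recovers the finite levels as `𝒮_K = 𝒮_{K_{𝔭̲}}/K^{𝔭̲}`; we type the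
  model LEVELWISE (`IntegralTower`: an `IntegralModel` over `O_{E_𝔭}` of `Sh_K ⊗_E E_𝔭` for every level, REAL ★
  `Motives.IntegralModel`, with transition maps compatible with the generic isomorphisms).
* «integral canonical model … in the sense of [Mil92, Definition 2.9]» / «the extension property» (C.20, C.21, C.22):
  [Liu2021] does not restate Milne's definition (J. S. Milne, *The points on a Shimura variety modulo a prime of good
  reduction*, in: The zeta functions of Picard modular surfaces (1992), Def. 2.9 — not held, not quoted) ⇒ ⟨CARRIER⟩
  predicate `HasExtensionProperty` on towers of `O_{E_𝔭}`-schemes (field of `Setup`, READING U6), exactly as «neat» is the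
  carrier `IsNeat` in `DefC1toC3`; the printed «(smooth)» and Def. C.21's «proper/smooth if `Sh_K` is» are REAL
  (Mathlib `AlgebraicGeometry.Smooth`, `IsProper`).
* Rem. C.22: `𝓜(V, 𝕎_0^∞, Φ)_{K,L_0}` (Def. C.19), `𝓜(𝕎_0^∞, Φ^c)_{L_0} ⊗_{O_{E_Φ,(p)}} O_{E♯_{V,Φ,𝔭}}` (Rem. C.13) and `q_0` (C.7)
  are the sibling carpet's objects ⇒ explicit PARAMETERS: a ring `R♯` = `O_{E♯_{V,Φ,𝔭}}` with `Algebra O_{E_𝔭} R♯`, two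
  `R♯`-schemes and a morphism; the fibre product `×_{O_{E_𝔭}}` read over `R♯` after base change (Mathlib `pullback` in
  `Scheme`; REAL).
* C.24–C.27 (READING U7): Mathlib has NO formal schemes, NO `p`-divisible groups of abelian schemes over `k`, NO
  Rapoport–Zink spaces; the formal schemes `𝓜^{ss,∧}`, `𝓜(𝕎_0^∞,Φ^c)^∧_{L_0}`, `𝒩`, the double quotient source of `u_ℙ`, and
  their morphisms `q_0^∧`, `ℙ^∧`, `ℙ^∧_{loc}`, `u_ℙ`, `T_g`, `T_{ḡ}` are ⟨CARRIER⟩S READ ON FUNCTORS OF POINTS over the test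
  objects of Liu's own proof (l. 5151: «Let `S` be a connected scheme in `Sch'_{/O^∧_{E_𝔭^{nr}}}` on which `p` is locally
  nilpotent, with a chosen geometric point `s ∈ S(k)`») — a carrier type `TestObj` and, for each formal scheme `X`, its
  `S`-points `X S : Type`; `Spf O^∧_{E_𝔭^{nr}}` is terminal (one `S`-point), so «Cartesian» in Prop. C.26 reads: `u_{ℙ,S}`
  is a bijection of the source's `S`-points onto the fibre `{x ∈ 𝓜^{ss,∧}(S) | q_0^∧(x) = q_0^∧(ℙ^∧_S)}` for every `S`
  (naturality in `S` is part of the MEANING of the carriers).  `V̄` is REAL (`HermSpace F E`; its construction (C.11)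
  from `ℙ` is the meaning of the field), and Lemma C.25 is typed on it: (1), (2), (7) REAL; (3), (4) as «the printed
  composite map — a ⟨CARRIER⟩ matrix in the bases of `V̄` and `V`, place by place (READING U8) — is an isometric
  isomorphism / an isomorphism» (REAL equations); (5) as «the canonical map (a ⟨CARRIER⟩ linear map `can` into a
  ⟨CARRIER⟩ module `HomMod`) is bijective»; (6) on a ⟨CARRIER⟩ frame of the lattice `Λ̄_𝔮` (REAL self-duality).  `Φ`, `𝕎_0^∞`, `L_0`, `𝔮^−` (the prime of `E` above
  `𝔮 ∈ Spl_p` lying in `Φ`, l. 4915) are the sibling carpet's data: `𝔮^−` is a ⟨CARRIER⟩ choice `qMinus`.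

WEAKER-THAN-PRINT: none intended; every carrier's printed definition is quoted at its field, and every typed clause is a
printed clause.  NOT TYPED (recorded above): Rem. C.23; «hyperspecial maximal» (l. 5123); «which is a Zariski closed
subset», «isomorphic to a finite disjoint union of `Spf O^∧`» (attributes of carriers, l. 5038, 5126); the proofs.
Nothing in this file is a claim that any statement of [Liu2021] holds; HC_CM is not addressed here (HC_CM is proved only
modulo the 7 printed citations (2 remaining: hLiu418 = stmt-HodgeConjecture-24832, h413 = stmt-HodgeConjecture-24833)
until rung 0 closes).

## References

* [Liu2021] Y. Liu, *Fourier–Jacobi cycles and arithmetic relative trace formula*, Camb. J. Math. 9 (2021) 1–147,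
  arXiv:2102.11518 — App. C §C.4: Prop. C.20 (p. 117), Def. C.21, Rem. C.22, Rem. C.23 (p. 119), Def. C.24 (p. 120),
  Lem. C.25 (p. 121), (C.13) (p. 122), Prop. C.26 (p. 123), Rem. C.27 (p. 124); §C.4 opening l. 4903–4917 (p. 116).
* [Mil92] J. S. Milne, *The points on a Shimura variety modulo a prime of good reduction* (1992), Def. 2.9, Thm. 2.10,
  Props. 2.11/2.13/2.14; [Kis10] M. Kisin, *Integral models for Shimura varieties of abelian type* (2010); [RZ96]
  M. Rapoport, Th. Zink, *Period spaces for p-divisible groups* (1996), Prop. 6.29, Thm. 6.30; [Mih] A. Mihatsch; [KR14]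
  S. Kudla, M. Rapoport — attributions printed by Liu (l. 4967, 4981, 4991, 5016, 5053, 5110–5111, 5152), not read here.
-/

noncomputable section

open NumberField IsDedekindDomain CategoryTheory AlgebraicGeometry Limits
open scoped Matrix MatrixGroups
open Literature.AlgebraicGeometry.Motives (SchemeOver IntegralModel baseChange)

namespace Literature.NumberTheory.Automorphic.Liu2021.AppendixC.SecC4IntegralModelsUniformization

/-! ## §1. Primes: inert / split / residue characteristic / unramified; the sets `𝔭̲` and `Spl_p` (l. 4906–4915, 4961–4962) -/

section Primes

variable {F : Type} (E : Type) [Field F] [Field E] [Algebra F E]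

/-- **«`𝔭` is inert in `E`»** (l. 4908, l. 4961) for a prime `𝔭` of `F`: the ideal `𝔭 · 𝓞_E` remains prime (READING U1, the
standard meaning; for the quadratic extension `E/F` this is: one prime of `E` above `𝔭`, unramified, residue degree `2`).
REAL. [cite: Liu2021, Prop. C.20 (p. 117); FJcycle.tex l. 4961] -/
def IsInert (𝔭 : HeightOneSpectrum (𝓞 F)) : Prop :=
  (𝔭.asIdeal.map (algebraMap (𝓞 F) (𝓞 E))).IsPrime

/-- **«primes of `F` … that are split in `E`»** (l. 4913, the set `Spl_p`): the prime `𝔮` of `F` has two distinct primes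
of `E` above it (READING U1; `UnitaryGroup.PlacesOver E 𝔮` = the primes `w` of `E` with `w ∩ 𝓞_F = 𝔮`). REAL.
[cite: Liu2021, App. C §C.4 (p. 116); FJcycle.tex l. 4913] -/
def IsSplit (𝔮 : HeightOneSpectrum (𝓞 F)) : Prop :=
  ∃ w w' : UnitaryGroup.PlacesOver E 𝔮, w ≠ w'

/-- **«the underlying rational prime `p`» / «the residue characteristic of `𝔭`»** (l. 4910, l. 4961–4962): the characteristic of
the residue field `𝓞_F ⧸ 𝔭` (Mathlib `ringChar`; the same one-liner as ★ `Literature.NumberTheory.GaloisCohomology.Howard2004.SelmerTriples.residueChar`,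
not imported here to keep this carpet's import cone inside `Automorphic` + `Motives`). REAL.
[cite: Liu2021, Prop. C.20 (p. 117); FJcycle.tex l. 4961–4962] -/
def residueChar (𝔭 : HeightOneSpectrum (𝓞 F)) : ℕ :=
  ringChar (𝓞 F ⧸ 𝔭.asIdeal)

/-- **«the underlying rational prime `p` is … unramified in `E`»** (l. 4910; l. 4961 «its underlying rational prime is
unramified in `E`»): every prime `𝔓` of `E` containing `p` has ramification index `1` over `ℤ` (Mathlib
`Ideal.ramificationIdx _ ℤ`, the index of `𝔓` over `𝔓 ∩ ℤ = (p)`; the same form as the field `unram` of the sibling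
`SecC3Connection.DefC19Data`; for the number ring `𝓞 E` equivalent to Mathlib's `Algebra.IsUnramifiedIn (𝓞 E)
(Ideal.span {(p : ℤ)})` of `Mathlib/RingTheory/Unramified/Locus`, residue fields being perfect). REAL.
[cite: Liu2021, Prop. C.20 (p. 117); FJcycle.tex l. 4961] -/
def IsUnramifiedRatPrime (p : ℕ) : Prop :=
  ∀ 𝔓 : HeightOneSpectrum (𝓞 E), (p : 𝓞 E) ∈ 𝔓.asIdeal → 𝔓.asIdeal.ramificationIdx ℤ = 1

/-- **`𝔭̲`, «the set of all primes of `F` with the same residue characteristic of `𝔭` that are inert in `E`»** (l. 4962; = l. 4912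
«the set of all primes of `F` above `p` that are inert in `E`»). REAL. [cite: Liu2021, Prop. C.20 (p. 117); FJcycle.tex l. 4962] -/
def inertSet (𝔭 : HeightOneSpectrum (𝓞 F)) : Set (HeightOneSpectrum (𝓞 F)) :=
  {𝔮 | residueChar 𝔮 = residueChar 𝔭 ∧ IsInert E 𝔮}

/-- **`Spl_p`, «the set of primes of `F` above `p` that are split in `E`»** (l. 4913), `p` the residue characteristic of `𝔭`.
REAL. [cite: Liu2021, App. C §C.4 (p. 116); FJcycle.tex l. 4913] -/
def splitSet (𝔭 : HeightOneSpectrum (𝓞 F)) : Set (HeightOneSpectrum (𝓞 F)) :=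
  {𝔮 | residueChar 𝔮 = residueChar 𝔭 ∧ IsSplit E 𝔮}

end Primes

/-! ## §2. `U(V)(F_𝔮)`, self-dual lattices in `V ⊗_F F_𝔮` and their stabilisers; `U(V)(𝔸_F^{∞,S})` (l. 4912–4917, 4962–4963, 5123) -/

section Local

variable {F E : Type} [Field F] [NumberField F] [IsTotallyReal F] [Field E] [NumberField E] [Algebra F E]
  [IsTotallyComplex E] [Algebra.IsQuadraticExtension F E]
variable (V : HermSpace F E)

/-- **`U(V)(F_𝔮)`** for a finite place `𝔮` of `F` (l. 4962: «a subgroup `K_𝔮 ⊆ U(V)(F_𝔮)`»), for `V` presented by its Gram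
matrix `J = V.gram` in the basis `V.basis` (READING R4 of `DefC1toC3`): the tree's `UnitaryGroup.localPi E c n J 𝔮 ≤
∏_{w∣𝔮} GL_n(E_w)`, `c = conj F E` (`V ⊗_F F_𝔮 = ∏_{w ∣ 𝔮} E_w^n`). REAL.
[cite: Liu2021, Prop. C.20 (p. 117); FJcycle.tex l. 4962] -/
abbrev localGroup (𝔮 : HeightOneSpectrum (𝓞 F)) : Subgroup (UnitaryGroup.LocalGLPi E V.n 𝔮) :=
  UnitaryGroup.localPi E (conj F E) V.n V.gram 𝔮

/-- The Gram matrix at `w ∣ 𝔮` of the frame `g = (g_w)_{w∣𝔮} ∈ ∏_{w∣𝔮} GL_n(E_w)` of `V ⊗_F F_𝔮`: `(c_* g_{c⁻¹w})ᵀ · J · g_w ∈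
M_n(E_w)` — the matrix of `( , )_V` on the columns of `g` (`c_* : E_{c⁻¹w} → E_w` the tree's `galAdicCompletionMap`, the same
convention as `UnitaryGroup.mem_localPi_iff`; READING U3). REAL. [cite: Liu2021, App. C §C.4 (p. 116); FJcycle.tex l. 4912] -/
def frameGram (𝔮 : HeightOneSpectrum (𝓞 F)) (g : UnitaryGroup.LocalGLPi E V.n 𝔮) (w : UnitaryGroup.PlacesOver E 𝔮) :
    Matrix (Fin V.n) (Fin V.n) (w.1.adicCompletion E) :=
  (((g (UnitaryGroup.PlacesOver.galInv (conj F E) w) :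
        GL (Fin V.n) ((UnitaryGroup.PlacesOver.galInv (conj F E) w).1.adicCompletion E)) :
        Matrix (Fin V.n) (Fin V.n) ((UnitaryGroup.PlacesOver.galInv (conj F E) w).1.adicCompletion E)).map
      (galAdicCompletionMap (conj F E) (smul_inv_smul (conj F E) w.1)))ᵀ *
    UnitaryGroup.placeForm V.gram w.1 *
    ((g w : GL (Fin V.n) (w.1.adicCompletion E)) : Matrix (Fin V.n) (Fin V.n) (w.1.adicCompletion E))

/-- **«a self-dual lattice `Λ_𝔮` in `V ⊗_F F_𝔮`»** (l. 4912; l. 4962–4963), READING U3: the lattice `Λ = g · ∏_{w∣𝔮} 𝒪_w^n`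
spanned over `∏_{w∣𝔮} 𝒪_w = 𝓞_E ⊗_{𝓞_F} 𝒪_{F_𝔮}` by the columns of the frame `g` is SELF-DUAL (`Λ = Λ^∨ := {x | (x, Λ)_V ⊆
∏_w 𝒪_w}`) iff its Gram matrix is unimodular: `frameGram V 𝔮 g w ∈ GL_n(𝒪_w)` (the tree's `glInt`) for every `w ∣ 𝔮`. REAL.
[cite: Liu2021, Prop. C.20 (p. 117); FJcycle.tex l. 4912, 4962–4963] -/
def IsSelfDualFrame (𝔮 : HeightOneSpectrum (𝓞 F)) (g : UnitaryGroup.LocalGLPi E V.n 𝔮) : Prop :=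
  ∀ w : UnitaryGroup.PlacesOver E 𝔮, ∃ u : GL (Fin V.n) (w.1.adicCompletion E),
    u ∈ glInt V.n (w.1.adicCompletion E) ∧
      (u : Matrix (Fin V.n) (Fin V.n) (w.1.adicCompletion E)) = frameGram V 𝔮 g w

/-- **«the stabilizer of [the lattice `Λ = g · ∏_w 𝒪_w^n`]» in `U(V)(F_𝔮)`** (l. 4917 «`K_𝔮` is the stabilizer of `Λ_𝔮`»;
l. 4962–4963): `U(V)(F_𝔮) ∩ g · (∏_{w∣𝔮} GL_n(𝒪_w)) · g⁻¹` (`u Λ = Λ ⇔ g⁻¹ u g ∈ ∏_w GL_n(𝒪_w)`; the tree's `localIntBox` is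
the stabiliser of the standard lattice), as a subgroup of `localGroup V 𝔮`. REAL.
[cite: Liu2021, Prop. C.20 (p. 117); FJcycle.tex l. 4917, 4962–4963] -/
def latticeStabilizer (𝔮 : HeightOneSpectrum (𝓞 F)) (g : UnitaryGroup.LocalGLPi E V.n 𝔮) : Subgroup (localGroup V 𝔮) :=
  ((UnitaryGroup.localIntBox E V.n 𝔮).map (MulAut.conj g).toMonoidHom).subgroupOf (localGroup V 𝔮)

/-- **«`K_𝔮 ⊆ U(V)(F_𝔮)` … is the stabilizer of a self-dual lattice in `V ⊗_F F_𝔮`»** (l. 4962–4963): there is a self-dual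
frame `g` with `K_𝔮 = latticeStabilizer V 𝔮 g`. REAL. [cite: Liu2021, Prop. C.20 (p. 117); FJcycle.tex l. 4962–4963] -/
def IsSelfDualStabilizer (𝔮 : HeightOneSpectrum (𝓞 F)) (K : Subgroup (localGroup V 𝔮)) : Prop :=
  ∃ g : UnitaryGroup.LocalGLPi E V.n 𝔮, IsSelfDualFrame V 𝔮 g ∧ K = latticeStabilizer V 𝔮 g

/-- **«`V ⊗_F F_𝔮` … admit[s] a self-dual lattice»** (Lem. C.25 (7), l. 5105: «`V̄ ⊗_F F_𝔭` does not admit a self-dual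
lattice»; l. 4912 «we may choose a self-dual lattice `Λ_𝔮` in `V ⊗_F F_𝔮`»): some frame is self-dual (READING U3). REAL.
[cite: Liu2021, Lem. C.25 (7) (p. 121); FJcycle.tex l. 4912, 5105] -/
def AdmitsSelfDualLattice (𝔮 : HeightOneSpectrum (𝓞 F)) : Prop :=
  ∃ g : UnitaryGroup.LocalGLPi E V.n 𝔮, IsSelfDualFrame V 𝔮 g

/-- **`U(V)(𝔸_F^{∞,S})`** for a set `S` of finite places of `F` (l. 4999 «`U(V)(𝔸_F^{∞,𝔭̲})`», l. 5138 «`U(V̄)(𝔸_F^{∞,𝔭})`»,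
l. 5147 «`U(V)(𝔸_F^{∞,𝔭̲})`, `U(V̄)(𝔸_F^{∞,𝔭̲})`»), READING U4: the subgroup of `U(V)(𝔸_F^∞) = V.Gfin` of elements whose
`𝔮`-component (`UnitaryGroup.evalPlace … 𝔮 : U(V)(𝔸_F^∞) →* U(V)(F_𝔮)`) is trivial for every `𝔮 ∈ S` — canonically
isomorphic to the printed restricted product over the finite places outside `S`. REAL.
[cite: Liu2021, Def. C.21 (p. 119), Prop. C.26 (p. 123); FJcycle.tex l. 4999, 5138, 5147] -/
def awayFrom (S : Set (HeightOneSpectrum (𝓞 F))) : Subgroup V.Gfin :=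
  ⨅ 𝔮 ∈ S, (UnitaryGroup.evalPlace F E (conj F E) V.n V.gram 𝔮).ker

end Local

/-! ## §3. The data of Proposition C.20 / Definition C.21 (l. 4903, 4961–4965, 4998–5003) -/

variable (F E : Type) [Field F] [NumberField F] [IsTotallyReal F] [Field E] [NumberField E] [Algebra F E]
  [IsTotallyComplex E] [Algebra.IsQuadraticExtension F E]

/-- **The data and standing hypotheses of [Liu2021, Prop. C.20 / Def. C.21]**, in paper order, over `F ⊆ E` (l. 4550; the
instance arguments).  ⟨CARRIER⟩ fields are posited data standing for printed objects Lean cannot construct (module docstring);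
the other fields are genuine objects / genuine printed hypotheses.  Nothing is asserted by this structure.
[cite: Liu2021, Prop. C.20 (p. 117), Def. C.21 (p. 119); FJcycle.tex l. 4903, 4961–4965, 4998–5003] -/
structure Setup : Type 1 where
  /-- «We identify `E` as a subfield of `ℂ` via an element `τ' ∈ Φ_E`» (l. 4903). REAL. -/
  τ' : E →+* ℂ
  /-- «We fix a hermitian space `V` over `E`» (l. 4903; l. 4961 «Let `V` be as in the beginning of this subsection»). REAL
  (★ `HermSpace`). -/
  V : HermSpace F E
  /-- «that has signature `(n−1,1)` at `τ := τ'|_F` and `(n,0)` at other places» (l. 4903). REAL hypothesis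
  (★ `HermSpace.IsSignatureN1At`, `restr F E τ' = τ'|_F`). -/
  sig : V.IsSignatureN1At (restr F E τ')
  /-- «Let `𝔭` be a prime of `F`» (l. 4961). REAL. -/
  𝔭 : HeightOneSpectrum (𝓞 F)
  /-- «inert in `E`» (l. 4961). REAL hypothesis (`IsInert`, READING U1). -/
  inert : IsInert E 𝔭
  /-- «such that its underlying rational prime is unramified in `E`» (l. 4961). REAL hypothesis. -/
  unramified : IsUnramifiedRatPrime E (residueChar 𝔭)
  /-- The prime of `E` above `𝔭` (unique, `𝔭` being inert; READING U2), through which «over `O_{E_𝔭}`» (l. 4967) is read: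
  `E_𝔭 = 𝔓.adicCompletion E`, `O_{E_𝔭} = 𝔓.adicCompletionIntegers E`. REAL datum (★ `UnitaryGroup.PlacesOver`). -/
  𝔓 : UnitaryGroup.PlacesOver E 𝔭
  /-- «We fix a subgroup `K_𝔮 ⊆ U(V)(F_𝔮)` … for every `𝔮 ∈ 𝔭̲`» (l. 4962–4963). REAL (a subgroup of `localGroup V 𝔮` for every
  finite place; only the values at `𝔮 ∈ 𝔭̲ = inertSet E 𝔭` are used). -/
  Kat : ∀ 𝔮 : HeightOneSpectrum (𝓞 F), Subgroup (localGroup V 𝔮)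
  /-- «that is the stabilizer of a self-dual lattice in `V ⊗_F F_𝔮` for every `𝔮 ∈ 𝔭̲`» (l. 4962–4963). REAL hypothesis
  (READING U3). -/
  selfDual : ∀ 𝔮 ∈ inertSet E 𝔭, IsSelfDualStabilizer V 𝔮 (Kat 𝔮)
  /-- «the Shimura variety … `Sh(G, h_{V,τ'})_{K^{𝔭̲}K_{𝔭̲}}` (see Remark C.2 for the notation) over `E`» (l. 4964–4967): the
  projective system `{Sh(G, h_{V,τ'})_K}_K` of Rem. C.2 for `V`, `τ'` — the ★ carrier structure `HermSpace.ShimuraSystem` of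
  `DefC1toC3` (its hypothesis field `sig_eq` repeats `sig`).  A datum; nothing asserted. -/
  S : V.ShimuraSystem τ'
  /-- ⟨CARRIER⟩ «`K` … of the form `K = K^{𝔭̲} × K_{𝔭̲}`» with `K^{𝔭̲} ⊆ U(V)(𝔸_F^{∞,𝔭̲})` open compact (sufficiently small)
  and `K_{𝔭̲} := ∏_{𝔮 ∈ 𝔭̲} K_𝔮` (l. 4963–4965, l. 5000–5001): the predicate singling out these levels inside
  `G(𝔸^∞) = U(V)(𝔸_F^∞) = V.Gfin`, i.e. the index set `{K^{𝔭̲}}` of the limit `lim_{K^{𝔭̲}}` (READING U5); anchored by the two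
  REAL fields below. -/
  IsLevel : Subgroup V.Gfin → Prop
  /-- Anchor 1 (REAL): a level `K = K^{𝔭̲} K_{𝔭̲}` is an open compact subgroup of `G(𝔸^∞)` (l. 5000 «an open compact subgroup
  `K ⊆ G(𝔸^∞) = U(V)(𝔸_F^∞)` of the form `K = K^{𝔭̲} × K_{𝔭̲}`»). -/
  isOpen_isCompact_of_isLevel : ∀ K, IsLevel K → IsOpen (K : Set V.Gfin) ∧ IsCompact (K : Set V.Gfin)
  /-- Anchor 2 (REAL): the `𝔮`-component of a level `K = K^{𝔭̲} × ∏_{𝔮∈𝔭̲} K_𝔮` is `K_𝔮`, for every `𝔮 ∈ 𝔭̲` (l. 4963–4965). -/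
  map_evalPlace_of_isLevel : ∀ K, IsLevel K → ∀ 𝔮 ∈ inertSet E 𝔭,
    K.map (UnitaryGroup.evalPlace F E (conj F E) V.n V.gram 𝔮) = Kat 𝔮
  /-- ⟨CARRIER⟩ **«integral canonical model … in the sense of [Mil92, Definition 2.9]»** (l. 4967) / «the extension
  property» (l. 4999, 5007): Milne's extension property for a tower `(𝒮_K)_K` of `O_{E_𝔭}`-schemes indexed by the levels
  (with its prime-to-`𝔭̲` Hecke action) — NOT restated in [Liu2021], hence posited (READING U6; cf. `IsNeat` in
  `DefC1toC3`).  Liu's proof (l. 4981–4993) uses it in the form: for an integral regular scheme `Y` over the base with dense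
  generic fibre `U`, every morphism `U → lim_{K^{𝔭̲}} 𝒮_{K^{𝔭̲}K_{𝔭̲},η}` extends uniquely to `Y`. -/
  HasExtensionProperty :
    ((K : Subgroup V.Gfin) → IsLevel K → SchemeOver (𝔓.1.adicCompletionIntegers E)) → Prop

namespace Setup

variable {F E}
variable (D : Setup F E)

/-- `𝔭̲` for the datum (l. 4962). REAL. [cite: Liu2021, Prop. C.20 (p. 117); FJcycle.tex l. 4962] -/
abbrev inertSet : Set (HeightOneSpectrum (𝓞 F)) := SecC4IntegralModelsUniformization.inertSet E D.𝔭

/-- `Spl_p` for the datum (l. 4913). REAL. [cite: Liu2021, App. C §C.4 (p. 116); FJcycle.tex l. 4913] -/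
abbrev splitSet : Set (HeightOneSpectrum (𝓞 F)) := SecC4IntegralModelsUniformization.splitSet E D.𝔭

/-- **`E_𝔭`**, the completion of `E` at (the prime above) `𝔭` (l. 4967, 4977; READING U2). REAL (Mathlib `adicCompletion`).
[cite: Liu2021, Prop. C.20 (p. 117); FJcycle.tex l. 4967] -/
abbrev Ep : Type := D.𝔓.1.adicCompletion E

/-- **`O_{E_𝔭}`**, «over `O_{E_𝔭}`» (l. 4967, 4998; READING U2). REAL (Mathlib `adicCompletionIntegers`, a valuation subring of
`E_𝔭`). [cite: Liu2021, Prop. C.20 (p. 117); FJcycle.tex l. 4967] -/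
abbrev Op : Type := D.𝔓.1.adicCompletionIntegers E

/-- **`Sh(G, h_{V,τ'})_K ⊗_E E_𝔭`**, the generic fibre an integral model over `O_{E_𝔭}` must have (l. 4967 «over `E` has a … model
over `O_{E_𝔭}`»; l. 4976–4979): base change of the level-`K` Shimura variety of the Rem. C.2 system along `E → E_𝔭` (★ `baseChange`).
REAL on the carrier `S`. [cite: Liu2021, Prop. C.20 (p. 117); FJcycle.tex l. 4964–4967] -/
def ShEp (K : Subgroup D.V.Gfin) : SchemeOver D.Ep :=
  (baseChange E D.Ep).obj (D.S.Sh K)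

end Setup

/-! ## §4. Proposition C.20 and Definition C.21 -/

/-- **A tower of integral models over `O_{E_𝔭}` of `{Sh(G, h_{V,τ'})_{K^{𝔭̲}K_{𝔭̲}}}_{K^{𝔭̲}}`** (the object whose existence
Prop. C.20 asserts and Def. C.21 names, READING U5): for every level `K = K^{𝔭̲}K_{𝔭̲}` an integral model `𝒮_K` over `O_{E_𝔭}` of
`Sh_K ⊗_E E_𝔭` (★ `Motives.IntegralModel`: an `O_{E_𝔭}`-scheme with an isomorphism of its generic fibre with `Sh_K ⊗_E E_𝔭`),
and transition maps `𝒮_{K'} → 𝒮_K` for `K' ≤ K` whose generic fibres are the transition maps of the Shimura tower (so that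
`𝒮_{K_{𝔭̲}} := lim_{K^{𝔭̲}} 𝒮_{K^{𝔭̲}K_{𝔭̲}}` is a model of `Sh_{K_{𝔭̲}} := lim Sh_{K^{𝔭̲}K_{𝔭̲}}`, l. 4964–4967, and
`𝒮_K = 𝒮_{K_{𝔭̲}}/K^{𝔭̲}`, l. 5001–5003).  A structure of data; nothing asserted.
[cite: Liu2021, Prop. C.20 (p. 117), Def. C.21 (p. 119); FJcycle.tex l. 4964–4967, 4998–5003] -/
structure IntegralTower (D : Setup F E) : Type 1 where
  /-- `𝒮_K`, an integral model over `O_{E_𝔭}` of `Sh_K ⊗_E E_𝔭`, for every level `K` (REAL ★ `IntegralModel`). -/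
  model : (K : Subgroup D.V.Gfin) → D.IsLevel K → IntegralModel D.Op D.Ep (D.ShEp K)
  /-- the transition map `𝒮_{K'} → 𝒮_K` over `O_{E_𝔭}` for levels `K' ≤ K`. -/
  tr : ∀ {K K' : Subgroup D.V.Gfin} (hK : D.IsLevel K) (hK' : D.IsLevel K'), K' ≤ K →
    ((model K' hK').total ⟶ (model K hK).total)
  /-- the generic fibre of `𝒮_{K'} → 𝒮_K` is `Sh_{K'} ⊗ E_𝔭 → Sh_K ⊗ E_𝔭` (through the generic isomorphisms). -/
  tr_generic : ∀ {K K' : Subgroup D.V.Gfin} (hK : D.IsLevel K) (hK' : D.IsLevel K') (h : K' ≤ K),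
    (baseChange D.Op D.Ep).map (tr hK hK' h) ≫ (model K hK).genericIso.hom =
      (model K' hK').genericIso.hom ≫ (baseChange E D.Ep).map (D.S.tr h)

namespace IntegralTower

variable {F E} {D : Setup F E} (T : IntegralTower F E D)

/-- The underlying tower of `O_{E_𝔭}`-schemes `K ↦ 𝒮_K` (the argument of the extension property, READING U6).
[cite: Liu2021, Prop. C.20 (p. 117); FJcycle.tex l. 4967] -/
def total : (K : Subgroup D.V.Gfin) → D.IsLevel K → SchemeOver D.Op :=
  fun K hK => (T.model K hK).total

/-- «(smooth)» (l. 4967): every `𝒮_K → Spec O_{E_𝔭}` is smooth (Mathlib `AlgebraicGeometry.Smooth`). REAL.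
[cite: Liu2021, Prop. C.20 (p. 117); FJcycle.tex l. 4967] -/
def IsSmoothTower : Prop :=
  ∀ (K : Subgroup D.V.Gfin) (hK : D.IsLevel K), AlgebraicGeometry.Smooth (T.model K hK).total.hom

end IntegralTower

/-- **[Liu2021, Proposition C.20] EXACTLY AS PRINTED** (l. 4960–4968, p. 117), for the datum `D` (its fields ARE the printed
hypotheses: `V` of signature `(n−1,1)` at `τ'|_F` and `(n,0)` elsewhere; `𝔭` inert with unramified residue characteristic;
`K_𝔮` the stabiliser of a self-dual lattice for `𝔮 ∈ 𝔭̲`; the Rem. C.2 tower `{Sh(G, h_{V,τ'})_K}`): «the Shimura variety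
`Sh(G, h_{V,τ'})_{K_{𝔭̲}} := lim_{K^{𝔭̲}} Sh(G, h_{V,τ'})_{K^{𝔭̲}K_{𝔭̲}}` over `E` has a (smooth) integral canonical model over `O_{E_𝔭}`
in the sense of [Mil92, Definition 2.9]» — TYPED (READINGS U2, U5, U6): there is an `IntegralTower` over `O_{E_𝔭}` that is
smooth and has the (posited) extension property `D.HasExtensionProperty`.  A consumer takes `(h : PropC20AsPrinted D)` for
ITS OWN `D`; nothing is claimed here.  NO PROOF (Liu: modification of [Mil92, Thm. 2.10] via Lem. C.18 and
[Mil92, Props. 2.11, 2.13, 2.14], l. 4970–4995). [cite: Liu2021, Prop. C.20 (p. 117); FJcycle.tex l. 4960–4968] -/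
def PropC20AsPrinted (D : Setup F E) : Prop :=
  ∃ T : IntegralTower F E D, T.IsSmoothTower ∧ D.HasExtensionProperty T.total

/-- **[Liu2021, Definition C.21] — the canonical integral model `𝒮(G, h_{V,τ'})`** EXACTLY AS PRINTED (l. 4998–5004, p. 119):
«We denote by `𝒮(G, h_{V,τ'})_{K_{𝔭̲}}` the integral canonical model of `Sh(G, h_{V,τ'})_{K_{𝔭̲}}` over `O_{E_𝔭}` in Proposition C.20,
on which the action of `U(V)(𝔸_F^{∞,𝔭̲})` extends uniquely by the extension property. For an open compact subgroup `K ⊆ G(𝔸^∞) =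
U(V)(𝔸_F^∞)` of the form `K = K^{𝔭̲} × K_{𝔭̲}`, we put `𝒮(G, h_{V,τ'})_K := 𝒮(G, h_{V,τ'})_{K_{𝔭̲}}/K^{𝔭̲}` which we refer as the
*canonical integral model* of `Sh(G, h_{V,τ'})_K` over `O_{E_𝔭}`.» — TYPED as the structure of a WITNESS of Prop. C.20 (an
integral tower that is smooth and has the extension property; READING U5: its value at the level `K` IS `𝒮(G, h_{V,τ'})_K =
𝒮_{K_{𝔭̲}}/K^{𝔭̲}`; the prime-to-`𝔭̲` Hecke action is part of the MEANING of the carrier `HasExtensionProperty`).  The last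
printed sentence «It is proper/smooth if `Sh(G, h_{V,τ'})_K` is» is the named fact `DefC21ProperSmooth`.  Nothing asserted.
[cite: Liu2021, Def. C.21 (p. 119); FJcycle.tex l. 4998–5004] -/
structure CanonicalIntegralModel (D : Setup F E) extends IntegralTower F E D where
  /-- «the integral canonical model … in Proposition C.20» is smooth («(smooth)», l. 4967). -/
  smooth : toIntegralTower.IsSmoothTower
  /-- «… by the extension property» (l. 4999): the tower has the (posited) extension property of [Mil92, Def. 2.9]. -/
  extensionProperty : D.HasExtensionProperty toIntegralTower.total

/-- **[Liu2021, Definition C.21, last sentence]** (l. 5003–5004, p. 119): «It [`𝒮(G, h_{V,τ'})_K`] is proper/smooth if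
`Sh(G, h_{V,τ'})_K` is» — for every level `K`: `Sh_K → Spec E` proper ⇒ `𝒮_K → Spec O_{E_𝔭}` proper, and `Sh_K` smooth ⇒ `𝒮_K`
smooth (Mathlib `IsProper`, `AlgebraicGeometry.Smooth`).  REAL on the carriers; NO PROOF. [cite: Liu2021, Def. C.21 (p. 119); FJcycle.tex l. 5003–5004] -/
def DefC21ProperSmooth (D : Setup F E) (𝒮 : CanonicalIntegralModel F E D) : Prop :=
  ∀ (K : Subgroup D.V.Gfin) (hK : D.IsLevel K),
    (IsProper (D.S.Sh K).hom → IsProper (𝒮.model K hK).total.hom) ∧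
      (AlgebraicGeometry.Smooth (D.S.Sh K).hom → AlgebraicGeometry.Smooth (𝒮.model K hK).total.hom)

/-! ## §5. Remark C.22 (the §C.3 / Def. C.19 objects enter as parameters) -/

/-- **[Liu2021, Remark C.22] EXACTLY AS PRINTED** (l. 5006–5012, p. 119): «The extension property of integral canonical models
together with Lemma C.18 implies that we have a canonical isomorphism
`𝓜(V, 𝕎_0^∞, Φ)_{K,L_0} ≃ 𝒮(G, h_{V,τ'})_K ×_{O_{E_𝔭}} (𝓜(𝕎_0^∞, Φ^c)_{L_0} ⊗_{O_{E_Φ,(p)}} O_{E♯_{V,Φ,𝔭}})` under which `q_0` (C.7)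
corresponds to the projection to the second factor.»  PARAMETERS (the sibling carpet's objects, not redeclared): `R♯` =
`O_{E♯_{V,Φ,𝔭}}` with its algebra structure over `O_{E_𝔭}` (l. 4915: `E♯_{V,Φ,𝔭}` the completion of `E♯_{V,Φ}` in `E_𝔭^{ac}`, an
extension of `E_𝔭`); `M` = `𝓜(V, 𝕎_0^∞, Φ)_{K,L_0}` (Def. C.19, an `R♯`-scheme); `M₀` = `𝓜(𝕎_0^∞, Φ^c)_{L_0} ⊗_{O_{E_Φ,(p)}} O_{E♯_{V,Φ,𝔭}}`
(Rem. C.13 base-changed, an `R♯`-scheme); `q₀ : M → M₀` = (C.7).  INSTANTIATION on the sibling carpet's datum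
`D₁₉ : SecC3Connection.DefC19Data F E V Φ` at a level `(K, L₀)`: `R♯ := ↥D₁₉.Osharp`, `M := D₁₉.𝓜.obj (K, L₀)`,
`M₀ := D₁₉.M0int.obj L₀`, `q₀ := D₁₉.bq0.app (K, L₀)` (the `O_{E_𝔭}`-algebra structure of `O_{E♯_{V,Φ,𝔭}}`, l. 4915, is the
consumer's).  TYPED: the fibre product `×_{O_{E_𝔭}}` is read over `R♯` as
`(𝒮_K ⊗_{O_{E_𝔭}} R♯) ×_{Spec R♯} M₀` (Mathlib `pullback` in `Scheme`), and the claim is: there is an isomorphism of `M` with it,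
over `R♯`, whose composite with the second projection is `q₀`.  NO PROOF. [cite: Liu2021, Rem. C.22 (p. 119); FJcycle.tex l. 5006–5012] -/
def RemC22AsPrinted (D : Setup F E) (𝒮 : CanonicalIntegralModel F E D) (K : Subgroup D.V.Gfin) (hK : D.IsLevel K)
    {Rsharp : Type} [CommRing Rsharp] [Algebra D.Op Rsharp]
    (M M₀ : SchemeOver Rsharp) (q₀ : M ⟶ M₀) : Prop :=
  ∃ e : M.left ≅ pullback ((baseChange D.Op Rsharp).obj (𝒮.model K hK).total).hom M₀.hom,
    e.hom ≫ pullback.snd _ _ = q₀.left ∧ e.hom ≫ pullback.fst _ _ ≫ ((baseChange D.Op Rsharp).obj (𝒮.model K hK).total).hom = M.hom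

/-! ## §6. The data of §C.4's uniformization (l. 4906–4917, 5020–5071, 5119–5131): Definition C.24, the frame `ℙ`, `𝒩`, `V̄` -/

/-- **The data of [Liu2021] §C.4, second half (uniformization along the basic locus)**, in paper order, extending the data of
Prop. C.20 (same `V`, `τ'`, `𝔭`, `𝔭̲`, `K_𝔮`), with the additional printed hypotheses of l. 4906–4917 and the objects of
l. 5020–5071 / 5119–5131.  Formal schemes and `p`-divisible groups do not exist in Mathlib / the tree: the formal schemes are
⟨CARRIER⟩S READ ON FUNCTORS OF POINTS over the test objects of Liu's proof (READING U7, module docstring); `V̄` is REAL.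
`Φ ∋ τ'`, `𝕎_0^∞`, `L_0` are the sibling carpet's data (§C.3) and enter only through the carriers.  Nothing is asserted by this
structure. [cite: Liu2021, Def. C.24 (p. 120), Lem. C.25 (p. 121), Prop. C.26 (p. 123); FJcycle.tex l. 4906–4917, 5020–5071, 5119–5131] -/
structure UniformizationData : Type 1 extends Setup F E where
  /-- «the underlying rational prime `p` is odd» (l. 4910). REAL hypothesis. -/
  p_odd : residueChar 𝔭 ≠ 2
  /-- «we may choose a self-dual lattice `Λ_𝔮` in `V ⊗_F F_𝔮` for every `𝔮 ∈ 𝔭̲`» (l. 4912): a self-dual frame of `Λ_𝔮`, with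
  `K_𝔮` its stabiliser (l. 4917 «`K_𝔮` is the stabilizer of `Λ_𝔮`»). REAL data + hypotheses (READING U3). -/
  Λ : ∀ 𝔮 : HeightOneSpectrum (𝓞 F), UnitaryGroup.LocalGLPi E V.n 𝔮
  Λ_selfDual : ∀ 𝔮 ∈ inertSet E 𝔭, IsSelfDualFrame V 𝔮 (Λ 𝔮)
  Kat_eq : ∀ 𝔮 ∈ inertSet E 𝔭, Kat 𝔮 = latticeStabilizer V 𝔮 (Λ 𝔮)
  /-- ⟨CARRIER⟩ `𝔮^−`, «for `𝔮 ∈ Spl_p`, we denote by `𝔮^−` the unique prime of `E` that is in `Φ`» (l. 4915) — depends on the CM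
  type `Φ` of §C.3 (sibling carpet); here a chosen prime of `E` above each `𝔮` (used for `𝔮 ∈ Spl_p` only). -/
  qMinus : ∀ 𝔮 : HeightOneSpectrum (𝓞 F), UnitaryGroup.PlacesOver E 𝔮
  /-- ⟨CARRIER⟩ the test objects (READING U7): «connected scheme[s] `S` in `Sch'_{/O^∧_{E_𝔭^{nr}}}` on which `p` is locally
  nilpotent, with a chosen geometric point `s ∈ S(k)`» (l. 5151), `k` the residue field of `E_𝔭^{nr}` (l. 5021). -/
  TestObj : Type
  /-- ⟨CARRIER⟩ `S ↦` the `S`-points of `𝓜(V, 𝕎_0^∞, Φ)^{ss,∧}_{K_{𝔭̲},L_0}`, «the completion of `𝓜(V, 𝕎_0^∞, Φ)^{nr}_{K,L_0}` along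
  [the supersingular locus] `𝓜(V, 𝕎_0^∞, Φ)^{ss}_{K_{𝔭̲},L_0}`, which is a formal scheme over `O^∧_{E_𝔭^{nr}}`» (l. 5038), where
  `𝓜^{nr}_{K_{𝔭̲},L_0} := lim_{K^p} lim_{K_p^{𝔭̲}} 𝓜(V, 𝕎_0^∞, Φ)^{nr}_{K^pK_p^{𝔭̲}K_{𝔭̲},L_0}` (l. 5025–5028) and `𝓜(V, 𝕎_0^∞, Φ)_{K,L_0}` is
  the integral moduli scheme of Def. C.19 (sibling carpet). -/
  Mss : TestObj → Type
  /-- ⟨CARRIER⟩ `S ↦` the `S`-points of `𝓜(𝕎_0^∞, Φ^c)^∧_{L_0}`, «the completion of `𝓜(𝕎_0^∞, Φ^c)_{L_0} ⊗_{O_{E_Φ,(p)}} O_{E_𝔭^{nr}}`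
  along the special fiber, which is isomorphic to a finite disjoint union of `Spf O^∧_{E_𝔭^{nr}}`» (l. 5126). -/
  M0 : TestObj → Type
  /-- ⟨CARRIER⟩ `q_0^∧ : 𝓜(V, 𝕎_0^∞, Φ)^{ss,∧}_{K_{𝔭̲},L_0} → 𝓜(𝕎_0^∞, Φ^c)^∧_{L_0}`, «(C.7) induces a morphism … of formal schemes over
  `O^∧_{E_𝔭^{nr}}`» (l. 5126–5131), on `S`-points. -/
  q0 : ∀ S, Mss S → M0 S
  /-- ⟨CARRIER⟩ the `k'`-points `𝓜(V, 𝕎_0^∞, Φ)^{nr}_{K_{𝔭̲},L_0}(k')` «for an algebraically closed field `k'` containing `k`» (Def. C.24,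
  l. 5031–5033), here for `k' = k`. -/
  kPts : Type
  /-- ⟨CARRIER⟩ **[Definition C.24]** «a `k'`-point `(A_0, i_0, λ_0, η_0^p; A, i, λ, η^p, η_p^{spl})` … is *supersingular* if the
  `p`-divisible group `A[𝔭^∞]` is supersingular» (l. 5030–5036): the predicate «`A[𝔭^∞]` is a supersingular `p`-divisible
  group» on `k`-points (no `p`-divisible groups over `k` in Mathlib / the tree). -/
  IsSupersingular : kPts → Prop
  /-- ⟨CARRIER⟩ `ℙ_k`, the reduction to `k` of the frame point (C.8) «`ℙ = (𝔸_0, 𝕚_0, 𝛌_0, 𝛈_0^p; 𝔸, 𝕚, 𝛌, 𝛈^p, 𝛈_p^{spl}) ∈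
  𝓜(V, 𝕎_0^∞, Φ)^{nr}_{K_{𝔭̲},L_0}(O_{E_𝔭^{nr}})`» (l. 5039–5042). -/
  Pk : kPts
  /-- «such that `ℙ_k` is supersingular» (l. 5043). Hypothesis on the carriers. -/
  Pk_supersingular : IsSupersingular Pk
  /-- ⟨CARRIER⟩ (C.9) «the induced section `ℙ^∧ : Spf O^∧_{E_𝔭^{nr}} → 𝓜(V, 𝕎_0^∞, Φ)^{ss,∧}_{K_{𝔭̲},L_0}`» (l. 5045), on `S`-points: its
  value on the unique `S`-point of the terminal object `Spf O^∧_{E_𝔭^{nr}}`. -/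
  P : ∀ S, Mss S
  /-- ⟨CARRIER⟩ `S ↦ 𝒩(S)`: «Let `𝒩` be the relative Rapoport–Zink space parameterizing quasi-isogenies of the supersingular
  unitary `O_{F_𝔭}`-module `(𝕏_k, 𝕚_k, 𝛌_k)` of signature `(n−1,1)` as introduced in Subsection 1.3, which is a formal scheme over
  `O^∧_{E_𝔭^{nr}}`» (l. 5053–5055), `(𝕏, 𝕚, 𝛌)` induced from `(𝔸[𝔭^∞], 𝕚[𝔭^∞], 𝛌[𝔭^∞])` via [Mih, Thm. 3.3] (l. 5053). -/
  N : TestObj → Type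
  /-- ⟨CARRIER⟩ (C.10) «the point `ℙ` induces a section `ℙ^∧_{loc} : Spf O^∧_{E_𝔭^{nr}} → 𝒩`» (l. 5055–5057), on `S`-points. -/
  Ploc : ∀ S, N S
  /-- **`V̄`** (l. 5059–5069): «`V̄ := Hom_k((𝔸_{0k}, 𝕚_{0k}), (𝔸_k, 𝕚_k))_ℚ`, which is an `E`-vector space through `𝕚_{0k}`», with
  the form (C.11) «`(x, y)_{V̄} = 𝕚_{0k}^{−1}(𝛌_{0k}^∨ ∘ y^∨ ∘ 𝛌_k ∘ x) ∈ 𝕚_{0k}^{−1} End_k((𝔸_{0k}, 𝕚_{0k})) = E`, which is a hermitian form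
  on `V̄`».  REAL as a hermitian space over `E` (★ `HermSpace`: rank `≥ 1`, hermitian, non-degenerate); its construction
  from `ℙ` is the MEANING of this field. -/
  Vbar : HermSpace F E
  /-- ⟨CARRIER⟩ Lem. C.25 (3), READING U8: the printed composite `V̄ ⊗_ℚ 𝔸^{∞,p} → Hom_{E⊗𝔸^{∞,p}}(H_1^{ét}(𝔸_{0k}, 𝔸^{∞,p}),
  H_1^{ét}(𝔸_k, 𝔸^{∞,p})) —(𝛈^p)^{−1}→ V ⊗_ℚ 𝔸^{∞,p}` (l. 5082–5086), an `E ⊗_ℚ 𝔸^{∞,p}`-linear map, read place by place at the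
  finite places `v` of `F` not above `p` as its matrix `γ_v ∈ M_{n × n̄}(E ⊗_F F_v)` in the bases `V̄.basis`, `V.basis`
  (`E ⊗_F F_v = UnitaryGroup.LocalRing E v`). -/
  γ3 : ∀ v : HeightOneSpectrum (𝓞 F), Matrix (Fin V.n) (Fin Vbar.n) (UnitaryGroup.LocalRing E v)
  /-- ⟨CARRIER⟩ Lem. C.25 (4), READING U8: the `𝔮`-component (`𝔮 ∈ Spl_p`) of the printed composite `∏_{𝔮∈Spl_p} V̄ ⊗_E E_{𝔮^−} →
  ∏ Hom_{O_{E_{𝔮^−}}}(𝔸_{0k}[(𝔮^−)^∞], 𝔸_k[(𝔮^−)^∞]) ⊗ E_{𝔮^−} —(𝛈_p^{spl})^{−1}→ ∏ V ⊗_E E_{𝔮^−}` (l. 5089–5094), as its matrix over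
  `E_{𝔮^−} = (qMinus 𝔮).adicCompletion E` in the bases of `V̄` and `V`. -/
  γ4 : ∀ 𝔮 : HeightOneSpectrum (𝓞 F), Matrix (Fin V.n) (Fin Vbar.n) ((qMinus 𝔮).1.adicCompletion E)
  /-- ⟨CARRIER⟩ Lem. C.25 (5): for `𝔮 ∈ 𝔭̲`, the `E_𝔮 = E ⊗_F F_𝔮`-vector space «`Hom_k((𝔸_{0k}[𝔮^∞], 𝕚_{0k}[𝔮^∞]),
  (𝔸_k[𝔮^∞], 𝕚_k[𝔮^∞])) ⊗_{O_{F_𝔮}} F_𝔮`» (l. 5097–5100; `k`-homomorphisms of `p`-divisible groups with `𝓞_E`-action — no Mathlib /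
  tree vocabulary, READING U7), as a module over `E ⊗_F F_𝔮 = UnitaryGroup.LocalRing E 𝔮` (values at `𝔮 ∉ 𝔭̲` unused). -/
  HomMod : HeightOneSpectrum (𝓞 F) → Type
  [homModAddCommGroup : ∀ 𝔮, AddCommGroup (HomMod 𝔮)]
  [homModModule : ∀ 𝔮, Module (UnitaryGroup.LocalRing E 𝔮) (HomMod 𝔮)]
  /-- ⟨CARRIER⟩ Lem. C.25 (5): «the canonical map `V̄ ⊗_F F_𝔮 → Hom_k((𝔸_{0k}[𝔮^∞], 𝕚_{0k}[𝔮^∞]), (𝔸_k[𝔮^∞], 𝕚_k[𝔮^∞])) ⊗_{O_{F_𝔮}} F_𝔮`»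
  (l. 5097–5100: `x ∈ V̄ = Hom_k((𝔸_{0k},𝕚_{0k}),(𝔸_k,𝕚_k))_ℚ ↦ x[𝔮^∞]`), an `E ⊗_F F_𝔮`-linear map out of `V̄ ⊗_F F_𝔮 =
  (E ⊗_F F_𝔮)^{n̄}` (coordinates `V̄.basis`, READING R4 of `DefC1toC3`). -/
  can : ∀ 𝔮 : HeightOneSpectrum (𝓞 F), (Fin Vbar.n → UnitaryGroup.LocalRing E 𝔮) →ₗ[UnitaryGroup.LocalRing E 𝔮] HomMod 𝔮
  /-- ⟨CARRIER⟩ for `𝔮 ∈ 𝔭̲`: a frame `ḡ_𝔮 ∈ ∏_{w∣𝔮} GL_{n̄}(E_w)` of the `𝓞_E ⊗ 𝒪_{F_𝔮}`-lattice «`Λ̄_𝔮 := Hom_k((𝔸_{0k}[𝔮^∞],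
  𝕚_{0k}[𝔮^∞]), (𝔸_k[𝔮^∞], 𝕚_k[𝔮^∞]))`» (Lem. C.25 (6), l. 5103) inside `V̄ ⊗_F F_𝔮` — a lattice of full rank there by Lem. C.25 (5)
  («the canonical map `V̄ ⊗_F F_𝔮 → Hom_k(…) ⊗_{O_{F_𝔮}} F_𝔮` is an isomorphism of `E_𝔮`-vector spaces», l. 5097–5101; READING U3). -/
  Λbar : ∀ 𝔮 : HeightOneSpectrum (𝓞 F), UnitaryGroup.LocalGLPi E Vbar.n 𝔮
  /-- ⟨CARRIER⟩ the group isomorphism `U(V̄)(𝔸_F^{∞,𝔭̲}) ≅ U(V)(𝔸_F^{∞,𝔭̲})` induced by (C.13) «`ι_ℙ : V̄ ⊗_F 𝔸_F^{∞,𝔭̲} → V ⊗_F 𝔸_F^{∞,𝔭̲}`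
  [an isomorphism] of hermitian spaces over `𝔸_F^{∞,𝔭̲}`» (l. 5119–5122; «`g` … and `ḡ` … that correspond under `ι_ℙ`», l. 5147),
  on the REAL groups of READING U4. -/
  iotaGrp : awayFrom Vbar (inertSet E 𝔭) ≃* awayFrom V (inertSet E 𝔭)
  /-- ⟨CARRIER⟩ `S ↦` the `S`-points of the source «`U(V̄)(F) \ (𝒩 × U(V̄)(𝔸_F^{∞,𝔭}) / ∏_{𝔮 ∈ 𝔭̲∖{𝔭}} K̄_𝔮)`» of `u_ℙ` (Prop. C.26,
  l. 5138), `K̄_𝔮` the stabiliser of `Λ̄_𝔮` (l. 5123) — a formal scheme over `O^∧_{E_𝔭^{nr}}` (cf. [RZ96, Thm. 6.30]). -/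
  Src : TestObj → Type
  /-- ⟨CARRIER⟩ the class map `(x, ḡ) ↦ [x, ḡ]` from `𝒩(S) × U(V̄)(𝔸_F^{∞,𝔭})` to the `S`-points of the double quotient (l. 5138;
  used by the first bullet of Prop. C.26, «`(ℙ^∧_{loc}, 1)`», l. 5145), `U(V̄)(𝔸_F^{∞,𝔭})` in READING U4. -/
  srcMk : ∀ S, N S → awayFrom Vbar {𝔭} → Src S
  /-- ⟨CARRIER⟩ «`T_g` … the Hecke translation on the target … of `u_ℙ`» for `g ∈ U(V)(𝔸_F^{∞,𝔭̲})` (l. 5147–5148), on `S`-points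
  of `𝓜(V, 𝕎_0^∞, Φ)^{ss,∧}_{K_{𝔭̲},L_0}`. -/
  T : awayFrom V (inertSet E 𝔭) → ∀ S, Mss S → Mss S
  /-- ⟨CARRIER⟩ «`T_{ḡ}` … the Hecke translation on the … source of `u_ℙ`» for `ḡ ∈ U(V̄)(𝔸_F^{∞,𝔭̲})` (l. 5147–5148), on `S`-points
  of the double quotient. -/
  Tbar : awayFrom Vbar (inertSet E 𝔭) → ∀ S, Src S → Src S

namespace UniformizationData

variable {F E}
variable (U : UniformizationData F E)

/-- **[Liu2021, Definition C.24]** (l. 5030–5036, p. 120): «we say that a `k'`-point … is *supersingular* if the `p`-divisible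
group `A[𝔭^∞]` is supersingular» — the definiens has no Mathlib / tree vocabulary (READING U7), so the definition is the
carrier predicate `U.IsSupersingular`; this alias records the printed name. [cite: Liu2021, Def. C.24 (p. 120); FJcycle.tex l. 5030–5036] -/
abbrev DefC24IsSupersingular (x : U.kPts) : Prop := U.IsSupersingular x

/-- **`K̄_𝔮`**, «the stabilizer of `Λ̄_𝔮` in Lemma C.25(6) for every `𝔮 ∈ 𝔭̲ ∖ {𝔭}`» (l. 5123), in `U(V̄)(F_𝔮)` (REAL on the carrier
frame `Λbar`; «which is a hyperspecial maximal subgroup of `U(V̄)(F_𝔮)`» is recorded, not typed).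
[cite: Liu2021, App. C (C.13) ff. (p. 122); FJcycle.tex l. 5123] -/
def Kbar (𝔮 : HeightOneSpectrum (𝓞 F)) : Subgroup (localGroup U.Vbar 𝔮) :=
  latticeStabilizer U.Vbar 𝔮 (U.Λbar 𝔮)

end UniformizationData

/-! ## §7. Lemma C.25 -/

section LemmaC25

variable {F E}
variable (U : UniformizationData F E)

/-- **[Liu2021, Lemma C.25 (1)]** (l. 5077, p. 121): «`V̄` is of dimension `n` over `E`.» REAL (`rank V̄ = rank V = n`). NO PROOF.
[cite: Liu2021, Lem. C.25 (1) (p. 121); FJcycle.tex l. 5077] -/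
def LemC25Part1 : Prop :=
  U.Vbar.n = U.V.n

/-- **[Liu2021, Lemma C.25 (2)]** (l. 5079, p. 121): «`V̄` is totally positive definite.» — signature `(n̄, 0)` at every `τ ∈ Φ_F`
(★ `HermSpace.sig`, READING R5 of `DefC1toC3`). REAL. NO PROOF (Liu: as [KR14, Lem. 2.7]).
[cite: Liu2021, Lem. C.25 (2) (p. 121); FJcycle.tex l. 5079] -/
def LemC25Part2 : Prop :=
  ∀ τ : F →+* ℝ, U.Vbar.sig τ = (U.Vbar.n, 0)

/-- **[Liu2021, Lemma C.25 (3)]** (l. 5081–5087, p. 121): «The composite map `V̄ ⊗_ℚ 𝔸^{∞,p} → Hom_{E ⊗_ℚ 𝔸^{∞,p}}(H_1^{ét}(𝔸_{0k},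
𝔸^{∞,p}), H_1^{ét}(𝔸_k, 𝔸^{∞,p})) —(𝛈^p)^{−1}→ V ⊗_ℚ 𝔸^{∞,p}` is an isomorphism of hermitian spaces over `F ⊗_ℚ 𝔸^{∞,p}`.» — TYPED
(READING U8) on the carrier matrices `γ_v = U.γ3 v` of the printed map: at every finite place `v` of `F` NOT above `p`, `γ_v`
is an ISOMETRY, `((c ⊗ 1) γ_v)ᵀ · J_V · γ_v = J_{V̄}` over `E ⊗_F F_v` (`c ⊗ 1` = ★ `UnitaryGroup.conjLocal`), and INVERTIBLE.
NO PROOF. [cite: Liu2021, Lem. C.25 (3) (p. 121); FJcycle.tex l. 5081–5087] -/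
def LemC25Part3 : Prop :=
  ∀ v : HeightOneSpectrum (𝓞 F), residueChar v ≠ residueChar U.𝔭 →
    ((U.γ3 v).map (UnitaryGroup.conjLocal E (conj F E) v))ᵀ *
          U.V.gram.map (algebraMap E (UnitaryGroup.LocalRing E v)) * U.γ3 v =
        U.Vbar.gram.map (algebraMap E (UnitaryGroup.LocalRing E v)) ∧
      ∃ δ : Matrix (Fin U.Vbar.n) (Fin U.V.n) (UnitaryGroup.LocalRing E v), U.γ3 v * δ = 1 ∧ δ * U.γ3 v = 1

/-- **[Liu2021, Lemma C.25 (4)]** (l. 5089–5095, p. 121): «The composite map `∏_{𝔮 ∈ Spl_p} V̄ ⊗_E E_{𝔮^−} → ∏_{𝔮 ∈ Spl_p}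
Hom_{O_{E_{𝔮^−}}}(𝔸_{0k}[(𝔮^−)^∞], 𝔸_k[(𝔮^−)^∞]) ⊗_{O_{E_{𝔮^−}}} E_{𝔮^−} —(𝛈_p^{spl})^{−1}→ ∏_{𝔮 ∈ Spl_p} V ⊗_E E_{𝔮^−}` is an isomorphism of
`∏_{𝔮 ∈ Spl_p} E_{𝔮^−}`-modules.» — TYPED (READING U8): for every `𝔮 ∈ Spl_p` the matrix `U.γ4 𝔮` over `E_{𝔮^−}` of the
`𝔮`-component is invertible. NO PROOF. [cite: Liu2021, Lem. C.25 (4) (p. 121); FJcycle.tex l. 5089–5095] -/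
def LemC25Part4 : Prop :=
  ∀ 𝔮 ∈ U.splitSet, ∃ δ : Matrix (Fin U.Vbar.n) (Fin U.V.n) ((U.qMinus 𝔮).1.adicCompletion E),
    U.γ4 𝔮 * δ = 1 ∧ δ * U.γ4 𝔮 = 1

/-- **[Liu2021, Lemma C.25 (5)]** (l. 5097–5101, p. 121): «For every `𝔮 ∈ 𝔭̲`, the canonical map `V̄ ⊗_F F_𝔮 →
Hom_k((𝔸_{0k}[𝔮^∞], 𝕚_{0k}[𝔮^∞]), (𝔸_k[𝔮^∞], 𝕚_k[𝔮^∞])) ⊗_{O_{F_𝔮}} F_𝔮` is an isomorphism of `E_𝔮`-vector spaces.» — TYPED on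
the carriers `U.HomMod 𝔮` (the target) and `U.can 𝔮` (the canonical map; READING U7): for every `𝔮 ∈ 𝔭̲`, `can` is
bijective. NO PROOF. [cite: Liu2021, Lem. C.25 (5) (p. 121); FJcycle.tex l. 5097–5101] -/
def LemC25Part5 : Prop :=
  ∀ 𝔮 ∈ U.inertSet, Function.Bijective (U.can 𝔮)

/-- **[Liu2021, Lemma C.25 (6)]** (l. 5103, p. 121): «For every `𝔮 ∈ 𝔭̲ ∖ {𝔭}`, `Λ̄_𝔮 := Hom_k((𝔸_{0k}[𝔮^∞], 𝕚_{0k}[𝔮^∞]),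
(𝔸_k[𝔮^∞], 𝕚_k[𝔮^∞]))` is a self-dual lattice in `V̄ ⊗_F F_𝔮`.» — TYPED on the carrier frame `U.Λbar 𝔮` of `Λ̄_𝔮` (READING U3):
the frame is self-dual for `( , )_{V̄}`. REAL predicate. NO PROOF. [cite: Liu2021, Lem. C.25 (6) (p. 121); FJcycle.tex l. 5103] -/
def LemC25Part6 : Prop :=
  ∀ 𝔮 ∈ U.inertSet, 𝔮 ≠ U.𝔭 → IsSelfDualFrame U.Vbar 𝔮 (U.Λbar 𝔮)

/-- **[Liu2021, Lemma C.25 (7)]** (l. 5105, p. 121): «`V̄ ⊗_F F_𝔭` does not admit a self-dual lattice.» REAL (READING U3).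
NO PROOF (Liu: from (1)–(6) and the Hasse principle). [cite: Liu2021, Lem. C.25 (7) (p. 121); FJcycle.tex l. 5105] -/
def LemC25Part7 : Prop :=
  ¬ AdmitsSelfDualLattice U.Vbar U.𝔭

/-- **[Liu2021, Lemma C.25] — all seven parts together** (l. 5074–5106, p. 121). NO PROOF (Liu: via [RZ96, Prop. 6.29],
display (C.12), [KR14, Lem. 2.7], the Hasse principle; l. 5108–5115). [cite: Liu2021, Lem. C.25 (p. 121); FJcycle.tex l. 5074–5106] -/
def LemC25AsPrinted : Prop :=
  LemC25Part1 U ∧ LemC25Part2 U ∧ LemC25Part3 U ∧ LemC25Part4 U ∧ LemC25Part5 U ∧ LemC25Part6 U ∧ LemC25Part7 U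

end LemmaC25

/-! ## §8. Proposition C.26 and Remark C.27 -/

section PropC26

variable {F E}
variable (U : UniformizationData F E)

/-- **[Liu2021, Proposition C.26] EXACTLY AS PRINTED** (l. 5135–5149, p. 123): «The chosen point `ℙ` (C.8) induces the following
Cartesian diagram [`u_ℙ : U(V̄)(F)\(𝒩 × U(V̄)(𝔸_F^{∞,𝔭})/∏_{𝔮 ∈ 𝔭̲∖{𝔭}} K̄_𝔮) → 𝓜(V, 𝕎_0^∞, Φ)^{ss,∧}_{K_{𝔭̲},L_0}` over
`q_0^∧ : 𝓜(V, 𝕎_0^∞, Φ)^{ss,∧}_{K_{𝔭̲},L_0} → 𝓜(𝕎_0^∞, Φ^c)^∧_{L_0} ← Spf O^∧_{E_𝔭^{nr}} : q_0^∧ ∘ ℙ^∧`] of formal schemes over `O^∧_{E_𝔭^{nr}}`,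
satisfying • `u_ℙ ∘ (ℙ^∧_{loc}, 1) = ℙ^∧` (see (C.9) and (C.10)), and • `u_ℙ ∘ T_{ḡ} = T_g ∘ u_ℙ` for every `g ∈ U(V)(𝔸_F^{∞,𝔭̲})`
and `ḡ ∈ U(V̄)(𝔸_F^{∞,𝔭̲})` that correspond under `ι_ℙ` (C.13), where `T_g` (resp. `T_{ḡ}`) denotes the Hecke translation on the
target (resp. source) of `u_ℙ`.» — TYPED (READING U7) on `S`-points: there is `u = (u_S)_S`, `u_S : Src(S) → 𝓜^{ss,∧}(S)`,
such that (Cartesian, the corner `Spf O^∧_{E_𝔭^{nr}}` being terminal) every `u_S` is injective with image the fibre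
`{x | q_0^∧(x) = q_0^∧(ℙ^∧_S)}`; `u_S [ℙ^∧_{loc,S}, 1] = ℙ^∧_S`; and `u_S ∘ T_{ḡ} = T_{ι_ℙ(ḡ)} ∘ u_S`.  NO PROOF (Liu: as
[RZ96, Thm. 6.30], constructing the inverse `v_ℙ` (C.14), l. 5151–5190). [cite: Liu2021, Prop. C.26 (p. 123); FJcycle.tex l. 5135–5149] -/
def PropC26AsPrinted : Prop :=
  ∃ u : ∀ S : U.TestObj, U.Src S → U.Mss S,
    (∀ S, Function.Injective (u S) ∧ Set.range (u S) = {x | U.q0 S x = U.q0 S (U.P S)}) ∧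
      (∀ S, u S (U.srcMk S (U.Ploc S) 1) = U.P S) ∧
        ∀ (gbar : awayFrom U.Vbar (inertSet E U.𝔭)) (S : U.TestObj) (x : U.Src S),
          u S (U.Tbar gbar S x) = U.T (U.iotaGrp gbar) S (u S x)

/-- **[Liu2021, Remark C.27]** (l. 5193–5195, p. 124): «the morphism `u_ℙ` in Proposition C.26 is compatible with more Hecke
operators. Consider a prime `𝔮 ∈ 𝔭̲ ∖ {𝔭}`. For every double coset `K_𝔮 g K_𝔮 ⊆ U(V)(F_𝔮)`, we have the Hecke correspondence
`T_{K_𝔮 g K_𝔮}` on the target of `u_ℙ` which is simply the Zariski closure of the usual Hecke correspondence on the generic fiber;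
it is in fact étale. Then we have `u_ℙ^* T_{K_𝔮 g K_𝔮} = T_{K̄_𝔮 ḡ K̄_𝔮}` if `K_𝔮 g K_𝔮 = K̄_𝔮 ḡ K̄_𝔮` under the canonical isomorphism
`K_𝔮\U(V)(F_𝔮)/K_𝔮 ≃ K̄_𝔮\U(V̄)(F_𝔮)/K̄_𝔮`. Here, `T_{K̄_𝔮 ḡ K̄_𝔮}` denotes the set-theoretical Hecke correspondence on the source of
`u_ℙ`.»  PARAMETERS (⟨CARRIER⟩, READING U7): `u` = `u_ℙ` of Prop. C.26 on `S`-points; `Tq 𝔮 g` = the correspondence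
`T_{K_𝔮 g K_𝔮}` on the target, as a set-valued map on `S`-points; `Tqbar 𝔮 ḡ` = `T_{K̄_𝔮 ḡ K̄_𝔮}` on the source; `ι 𝔮 : U(V̄)(F_𝔮) ≃*
U(V)(F_𝔮)` = an isomorphism carrying `K̄_𝔮` onto `K_𝔮` through which «the canonical isomorphism» of double coset spaces is
read (both groups being the unitary group of the split hermitian space with a self-dual lattice at `𝔮 ≠ 𝔭`, (C.13)).  TYPED:
for `𝔮 ∈ 𝔭̲ ∖ {𝔭}` and `ḡ ∈ U(V̄)(F_𝔮)`, the PULL-BACK of the correspondence along `u_ℙ` is `T̄`: on `S`-points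
`u_S⁻¹(T_{K_𝔮 ι(ḡ) K_𝔮}(u_S x)) = T_{K̄_𝔮 ḡ K̄_𝔮}(x)` («`u_ℙ^* T = T̄`»: the pull-back of `T ⊆ Y × Y` along `u : X → Y` is
`(u × u)⁻¹ T`, i.e. `x' ∈ T̄(x) ↔ u x' ∈ T(u x)`; nothing is claimed about points of `T(u_S x)` outside the image of `u_S`).  The
attributes «Zariski closure of the usual Hecke correspondence», «étale» are recorded, not typed. NO PROOF. [cite: Liu2021, Rem. C.27 (p. 124); FJcycle.tex l. 5193–5195] -/
def RemC27AsPrinted (u : ∀ S : U.TestObj, U.Src S → U.Mss S)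
    (Tq : ∀ 𝔮 : HeightOneSpectrum (𝓞 F), localGroup U.V 𝔮 → ∀ S : U.TestObj, U.Mss S → Set (U.Mss S))
    (Tqbar : ∀ 𝔮 : HeightOneSpectrum (𝓞 F), localGroup U.Vbar 𝔮 → ∀ S : U.TestObj, U.Src S → Set (U.Src S))
    (ι : ∀ 𝔮 : HeightOneSpectrum (𝓞 F), localGroup U.Vbar 𝔮 ≃* localGroup U.V 𝔮) : Prop :=
  ∀ 𝔮 ∈ U.inertSet, 𝔮 ≠ U.𝔭 →
    (U.Kbar 𝔮).map (ι 𝔮).toMonoidHom = U.Kat 𝔮 →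
      ∀ (gbar : localGroup U.Vbar 𝔮) (S : U.TestObj) (x : U.Src S),
        u S ⁻¹' (Tq 𝔮 (ι 𝔮 gbar) S (u S x)) = Tqbar 𝔮 gbar S x

end PropC26

end Literature.NumberTheory.Automorphic.Liu2021.AppendixC.SecC4IntegralModelsUniformization

end
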